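import Summits.ABC.IUTFork.LanaLogLinkLiftingHolds
import Summits.ABC.IUTFork.LanaLogLinkLiftingBad
import HarnessLib

/-!
# L-LANA objects IX nonies: the continuity clause `hcont` is NECESSARY (`LiftExists ⟹ hcont`), EQUIVALENT to
# `LiftExists` at the `ℚ_p` datum, and HOLDS on the geometric (inner) locus

Record-only, proof-only sequel (D-0012; seat abc-iut-w6-d027 gen 5, block C / W6 cone prover, L-LANA level,
plan/LLANA-SPEC N12) of `LanaLogLinkLifting.lean` (c312-4 gen 4: LANA §5.3 (a) "any isomorphism of `D`-prime strips
can be uniquely lifted to an isomorphism of `F`-prime strips" ⟺ `LiftExists ∧ LiftUnique` at each reference datum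
`F_v = (Π_v ↷ O^▷_v)`), `LanaLogLinkLiftingHolds.lean` / `LanaLogLinkLiftingBad.lean` (gen 5 / w6-d027 gen 2: at the
`ℚ_p` datum, at good-place data and at bad-place data the UNIQUENESS half is a theorem and the EXISTENCE half follows
from the continuity clause `hcont` — LANA Def. 3.7.1 p. 20: isomorphisms of GM-data are HOMEOMORPHISMS on the monoid
`M = O^▷_v`, a clause [AbsTopIII] Def. 3.1 (ii) / Rmk. 3.1.1 p. 70 omits — plus the characteristicity `hker` of the
arithmetic kernel) and `LanaPadicPairAutomorphisms.lean` (c312-4 gen 6: every automorphism of the pair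
`(G_{ℚ_p} ↷ O^▷_{ℚ̄_p})` extends to `ℚ̄_pˣ` and preserves `|·|_p`; `hcont` itself left OPEN).  TAKES NO SIDE on
[IUTchIII] Cor. 3.12.  THIS file pins the residual `hcont` from both sides, with NO new definition and NO new named
fact:

* §1 **`RefLocalDatum.continuous_isoM_of_exists_lift` / `continuous_isoM_of_liftExists`** — at ANY reference datum
  whose `F_v` is an MLF-Galois `TM`-pair, an automorphism `e = (e_Π, e_M)` of the pair over whose Galois component
  SOME isomorphism of the GM-data lies has `e_M` bi-continuous; hence `LiftExists ⟹ hcont`: the continuity clause is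
  NECESSARY for LANA's existence half, not an artefact of the gen-4/5 proofs (mechanism: [AbsTopIII] Prop. 3.2 (iv)
  injectivity — the tree theorem `pairIsoDeterminedByGalois_holds` — the GM-lift and `e` share `e_Π`, so `e_M` IS the
  lift's homeomorphism with its topology forgotten);
* §2 **`RefLocalDatum.exists_lift_inner`, `continuous_isoM_of_isoPi_inner`** — the GEOMETRIC locus is discharged at
  every reference datum: an INNER automorphism `σ ↦ πσπ⁻¹` of `Π_v` lifts to the GM-data `F_v` (monoid part = the
  action of `ρ(π) ∈ G_v`, a homeomorphism of `O^▷_v`), so every pair automorphism with inner Galois component has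
  bi-continuous monoid part;
* §3 **`padicRef_liftExists_iff_cont`, `uniqueLifting_padicRef_iff_cont`** — at the `ℚ_p` datum
  `hcont ⟺ LiftExists ⟺ UniqueLifting` (the latter for a non-empty family of places); **`padicPair_cont_iff_forall_lift`**
  — equivalently: every topological automorphism `f` of `G_{ℚ_p}` has a (necessarily unique) lift to the pair with
  bi-continuous monoid part (lifts exist by [IUTchII] Rmk. 1.11.1 (i) (a), tree theorem
  `galoisIsoLiftsToTMPairIsoOfMonoAnalytic_holds`); `padicPair_continuous_isoM_of_inner` (inner = geometric here:
  `Aut(ℚ̄_p/ℚ_p) = G_{ℚ_p}`); §3 bis / ter the same at good-place data (`good_liftExists_iff_cont_of_char`,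
  `good_uniqueLifting_iff_cont_of_char`) and bad-place data (`bad_liftExists_iff_cont_of_char`,
  `continuous_isoM_of_uniqueLifting_bad`).

HONEST SCOPE.  (i) `hcont` is NOT discharged: by §1–§3 it is EXACTLY the statement that the unique lift `e_f` of
every topological automorphism `f` of `Π_v` (at the `ℚ_p` datum: the class-field-theoretic transport of `ℚ̄_pˣ`
along `f`, [AbsAnab] Prop. 1.2.1 (vi)) is a homeomorphism of `O^▷_{ℚ̄_p}`, and it holds for inner `f`; for a
NON-inner `f` of `G_{ℚ_p}` — whose existence is expected from the Jannsen–Wingberg presentation of `G_{ℚ_p}` but is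
not a tree statement — `e_f : O_L^× ⥲ O_{L'}^×` is bi-continuous at each finite level `L` (both profinite) and the
open point is UNIFORMITY in `L` of the modulus of continuity at `1`; recorded, not judged (seat memo
HOME/staging/w6/w6-d027/g5/HCONT-STUDY.md).  (ii) Consequently LANA's existence half at the group-level `ℚ_p` datum
STANDS OR FALLS with `hcont` (§3): a reading of LANA Def. 3.7.1 without the homeomorphism clause on `M` ([AbsTopIII]
Rmk. 3.1.1) makes pair-level existence the tree theorem `galoisIsoLiftsToTMPairIsoOfMonoAnalytic_holds`; a reading
restricting `D`-prime-strip isomorphisms to geometric ones makes it §2.  Neither reading is adopted here.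
(iii) Archimedean places: none (`RefLocalDatum` is nonarchimedean).
[cite: LANA2026Report, Def. 3.7.1 p. 20, §5.3 (a) p. 29] [cite: MochizukiAbsTopIII2015, Proposition 3.2 (iv) p.72]
[cite: Mochizuki2012, II Rmk 1.11.1 (i) p.50] [cite: MochizukiAbsAnab2004, Prop 1.2.1 (vi) p.10] NOT here: any judgement.
-/

noncomputable section

namespace Summit.ABC
namespace IUTFork

open Literature.AnabelianGeometry.AbsoluteAnabelian
open Topology

/-! ## 1. `LiftExists ⟹ hcont` at every MLF-Galois `TM` reference datum -/

namespace RefLocalDatum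

variable (L : RefLocalDatum) (hst : ∀ a : intMonoid L.w, IsOpen (MulAction.stabilizer L.G a : Set L.G))

/-- **An automorphism of the pair `F_v = (Π_v ↷ O^▷_v)` over whose Galois component an isomorphism of the GM-data
lies has bi-continuous monoid part** (for `F_v` an MLF-Galois `TM`-pair): the GM-lift `Φ` and `e` share `e_Π`, so by
[AbsTopIII] Prop. 3.2 (iv) injectivity (`pairIsoDeterminedByGalois_holds`, a tree theorem) `e_M = Φ_M` with its
topology forgotten — and `Φ_M` is a homeomorphism (LANA Def. 3.7.1).
[cite: MochizukiAbsTopIII2015, Proposition 3.2 (iv) p.72] [cite: LANA2026Report, Def. 3.7.1 p. 20] -/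
theorem continuous_isoM_of_exists_lift (hMLF : IsMLFGaloisMonoidPair .TM (L.toPair hst))
    (e : GaloisMonoidPair.Iso (L.toPair hst) (L.toPair hst)) (h : ∃ Φ : GMData.Iso L.Fhol L.Fhol, Φ.eG = e.isoPi) :
    Continuous e.isoM ∧ Continuous e.isoM.symm := by
  obtain ⟨Φ, hΦ⟩ := h
  have hM : (L.isoToPairIso hst Φ).isoM = e.isoM :=
    pairIsoDeterminedByGalois_holds _ _ hMLF hMLF _ _ ((L.isoToPairIso_isoPi hst Φ).trans hΦ)
  have h₁ : Continuous (L.isoToPairIso hst Φ).isoM := Φ.eM.continuous_toFun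
  have h₂ : Continuous (L.isoToPairIso hst Φ).isoM.symm := Φ.eM.continuous_invFun
  rw [hM] at h₁ h₂
  exact ⟨h₁, h₂⟩

/-- **`LiftExists ⟹ hcont`**: if every topological automorphism of `Π_v` lifts to an automorphism of the GM-data `F_v`
(LANA §5.3 (a), existence half, AT THE REFERENCE DATUM), then every automorphism of the pair `F_v` has bi-continuous
monoid part — the continuity clause of `liftExists_of_galoisIsoLifts` is NECESSARY, not only sufficient.
[cite: LANA2026Report, §5.3 (a) p. 29, Def. 3.7.1 p. 20] [cite: MochizukiAbsTopIII2015, Proposition 3.2 (iv) p.72] -/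
theorem continuous_isoM_of_liftExists (hMLF : IsMLFGaloisMonoidPair .TM (L.toPair hst)) (hE : L.LiftExists)
    (e : GaloisMonoidPair.Iso (L.toPair hst) (L.toPair hst)) : Continuous e.isoM ∧ Continuous e.isoM.symm :=
  L.continuous_isoM_of_exists_lift hst hMLF e (hE e.isoPi)

/-! ## 2. The geometric (inner) locus: inner automorphisms of `Π_v` lift, with continuous monoid part -/

/-- **Inner automorphisms of `Π_v` lift to the GM-data `F_v = (Π_v ↷ O^▷_v)`** (no hypothesis): over `σ ↦ πσπ⁻¹`
lies the isomorphism of GM-data whose monoid part is the action of `ρ(π) ∈ G_v` on `O^▷_v` — a homeomorphism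
(`G_v ↷ O^▷_v` is continuous, LANA §3.7) — and `ρ(π)·(ρ(g)·a) = ρ(πgπ⁻¹)·(ρ(π)·a)`.
[cite: LANA2026Report, Def. 3.7.1 p. 20, §3.10 p. 22] -/
theorem exists_lift_inner (π : L.P) : ∃ Φ : GMData.Iso L.Fhol L.Fhol, ∀ σ : L.P, Φ.eG σ = π * σ * π⁻¹ := by
  let eG : L.P ≃ₜ* L.P :=
    { toFun := fun σ => π * σ * π⁻¹
      invFun := fun σ => π⁻¹ * σ * π
      left_inv := fun σ => by simp [mul_assoc]
      right_inv := fun σ => by simp [mul_assoc]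
      map_mul' := fun σ σ' => by simp [mul_assoc]
      continuous_toFun := by fun_prop
      continuous_invFun := by fun_prop }
  let eM : intMonoid L.w ≃ₜ* intMonoid L.w :=
    { toFun := fun a => L.ρ π • a
      invFun := fun a => (L.ρ π)⁻¹ • a
      left_inv := fun a => inv_smul_smul (L.ρ π) a
      right_inv := fun a => smul_inv_smul (L.ρ π) a
      map_mul' := fun a b => smul_mul' (L.ρ π) a b
      continuous_toFun := continuous_const_smul (L.ρ π)
      continuous_invFun := continuous_const_smul (L.ρ π)⁻¹ }
  -- equivariance, computed in `G_v ↷ O^▷_v`: `ρ(π)·(ρ(g)·a) = ρ(πgπ⁻¹)·(ρ(π)·a)`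
  have key : ∀ (g : L.P) (a : intMonoid L.w), L.ρ π • (L.ρ g • a) = L.ρ (π * g * π⁻¹) • (L.ρ π • a) :=
    fun g a => by simp only [map_mul, map_inv, smul_smul, inv_mul_cancel_right]
  exact ⟨⟨eG, eM, fun g a => key g a⟩, fun σ => rfl⟩

/-- **`hcont` on the inner locus**: for `F_v` an MLF-Galois `TM`-pair, every automorphism of the pair whose Galois
component is INNER has bi-continuous monoid part (§1 applied to the lift of §2).
[cite: MochizukiAbsTopIII2015, Proposition 3.2 (iv) p.72] [cite: LANA2026Report, Def. 3.7.1 p. 20] -/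
theorem continuous_isoM_of_isoPi_inner (hMLF : IsMLFGaloisMonoidPair .TM (L.toPair hst))
    (e : GaloisMonoidPair.Iso (L.toPair hst) (L.toPair hst)) (π : L.P) (h : ∀ σ : L.P, e.isoPi σ = π * σ * π⁻¹) :
    Continuous e.isoM ∧ Continuous e.isoM.symm := by
  obtain ⟨Φ, hΦ⟩ := L.exists_lift_inner π
  exact L.continuous_isoM_of_exists_lift hst hMLF e ⟨Φ, ContinuousMulEquiv.ext fun σ => (hΦ σ).trans (h σ).symm⟩

end RefLocalDatum

/-! ## 3. The `ℚ_p` datum: `hcont ⟺ LiftExists ⟺ UniqueLifting ⟺ (every `f ∈ Aut_top(G_{ℚ_p})` has a continuous lift)` -/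

section Padic

variable (p : ℕ) [Fact p.Prime]

/-- **At the `ℚ_p` datum, `LiftExists ⟺ hcont`**: LANA's existence half at `F_v = (G_{ℚ_p} ↷ O^▷_{ℚ̄_p})` holds
if and only if every automorphism of the pair has bi-continuous monoid part (`⟸` is gen 5's
`padicRef_liftExists_of_cont`; `⟹` is §1). [cite: LANA2026Report, §5.3 (a) p. 29, Def. 3.7.1 p. 20]
[cite: MochizukiAbsTopIII2015, Proposition 3.2 (iv) p.72] -/
theorem padicRef_liftExists_iff_cont :
    (padicRef p).LiftExists ↔
      ∀ e : GaloisMonoidPair.Iso (padicPair p) (padicPair p), Continuous e.isoM ∧ Continuous e.isoM.symm :=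
  ⟨fun h e => (padicRef p).continuous_isoM_of_liftExists (padicRef_stabilizer_isOpen p)
      (isMLFGaloisMonoidPair_padicPair p) h e,
    padicRef_liftExists_of_cont p⟩

/-- **At the `ℚ_p` datum, `UniqueLifting ⟺ hcont`** for any NON-EMPTY family of places all carrying the `ℚ_p`
reference datum (uniqueness being unconditional, `padicRef_liftUnique`).
[cite: LANA2026Report, §5.3 (a) p. 29] [cite: MochizukiAbsTopIII2015, Proposition 3.2 (iv) p.72] -/
theorem uniqueLifting_padicRef_iff_cont {V : Type} [Nonempty V] :
    UniqueLifting (fun _ : V => padicRef p) ↔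
      ∀ e : GaloisMonoidPair.Iso (padicPair p) (padicPair p), Continuous e.isoM ∧ Continuous e.isoM.symm :=
  ⟨fun h => (padicRef_liftExists_iff_cont p).1 (liftExists_of_uniqueLifting h (Classical.arbitrary V)),
    uniqueLifting_padicRef_of_cont p⟩

/-- **`hcont` at the `ℚ_p` datum is a property of `Aut_top(G_{ℚ_p})`**: it holds iff EVERY topological automorphism
`f` of `G_{ℚ_p}` admits a lift to the pair with bi-continuous monoid part (lifts exist by [IUTchII] Rmk. 1.11.1 (i)
(a), `galoisIsoLiftsToTMPairIsoOfMonoAnalytic_holds`, and are unique by [AbsTopIII] Prop. 3.2 (iv) injectivity).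
[cite: Mochizuki2012, II Rmk 1.11.1 (i) p.50] [cite: MochizukiAbsTopIII2015, Proposition 3.2 (iv) p.72] -/
theorem padicPair_cont_iff_forall_lift :
    (∀ e : GaloisMonoidPair.Iso (padicPair p) (padicPair p), Continuous e.isoM ∧ Continuous e.isoM.symm) ↔
      ∀ f : (padicPair p).Pi ≃ₜ* (padicPair p).Pi, ∃ e : GaloisMonoidPair.Iso (padicPair p) (padicPair p),
        e.isoPi = f ∧ Continuous e.isoM ∧ Continuous e.isoM.symm := by
  refine ⟨fun h f => ?_, fun h e => ?_⟩
  · obtain ⟨e, he⟩ := galoisIsoLiftsToTMPairIsoOfMonoAnalytic_holds _ _ (isMLFGaloisMonoidPair_padicPair p)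
      (isMLFGaloisMonoidPair_padicPair p) (isOfMonoAnalyticTypeMonoid_padicPair p)
      (isOfMonoAnalyticTypeMonoid_padicPair p) f
    exact ⟨e, he, h e⟩
  · obtain ⟨e', he', hc⟩ := h e.isoPi
    have hM : e'.isoM = e.isoM :=
      pairIsoDeterminedByGalois_holds _ _ (isMLFGaloisMonoidPair_padicPair p) (isMLFGaloisMonoidPair_padicPair p)
        _ _ he'
    rw [hM] at hc
    exact hc

/-- **`hcont` holds over the geometric automorphisms of `G_{ℚ_p}`**: an automorphism of the pair
`(G_{ℚ_p} ↷ O^▷_{ℚ̄_p})` whose Galois component is conjugation by some `τ ∈ G_{ℚ_p}` (for `ℚ_p`, inner = induced by a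
field automorphism of `ℚ̄_p/ℚ_p`) has bi-continuous monoid part — it IS the action of `τ`.
[cite: MochizukiAbsTopIII2015, Proposition 3.2 (iv) p.72] [cite: LANA2026Report, Def. 3.7.1 p. 20] -/
theorem padicPair_continuous_isoM_of_inner (e : GaloisMonoidPair.Iso (padicPair p) (padicPair p))
    (τ : (padicRef p).P) (h : ∀ σ : (padicRef p).P, e.isoPi σ = τ * σ * τ⁻¹) :
    Continuous e.isoM ∧ Continuous e.isoM.symm :=
  (padicRef p).continuous_isoM_of_isoPi_inner (padicRef_stabilizer_isOpen p) (isMLFGaloisMonoidPair_padicPair p) e τ h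

end Padic

/-! ## 3 bis. Good-place data `RefLocalDatum.ofExtension p E e` (`Π_v = E.arith` profinite) -/

section Good

variable (p : ℕ) [Fact p.Prime] (E : FundamentalExtension.{0}) (e : E.gal ≃ₜ* PadicGal p)

/-- **At a good-place datum, `LiftExists ⟹ hcont`** (unconditional: uniqueness is a theorem there).
[cite: LANA2026Report, §5.3 (a) p. 29, Def. 3.7.1 p. 20] [cite: MochizukiAbsTopIII2015, Proposition 3.2 (iv) p.72] -/
theorem good_continuous_isoM_of_liftExists (hE : (RefLocalDatum.ofExtension p E e).LiftExists)
    (f : GaloisMonoidPair.Iso (goodPair p E e) (goodPair p E e)) : Continuous f.isoM ∧ Continuous f.isoM.symm :=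
  (RefLocalDatum.ofExtension p E e).continuous_isoM_of_liftExists (padicRef_stabilizer_isOpen p)
    (isMLFGaloisMonoidPair_goodPair p E e) hE f

/-- **At a good-place datum with characteristic `Δ_v`, `LiftExists ⟺ hcont`** (`⟸` is gen 5's
`good_liftExists_of_char_of_cont`). [cite: LANA2026Report, §5.3 (a) p. 29] [cite: Mochizuki2012, II Prop 1.6 p.31]
[cite: MochizukiAbsTopIII2015, Proposition 3.2 (iv) p.72] -/
theorem good_liftExists_iff_cont_of_char
    (hker : Literature.AnabelianGeometry.EtaleTheta.IsTopCharacteristic E.arith E.geom) :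
    (RefLocalDatum.ofExtension p E e).LiftExists ↔
      ∀ f : GaloisMonoidPair.Iso (goodPair p E e) (goodPair p E e), Continuous f.isoM ∧ Continuous f.isoM.symm :=
  ⟨good_continuous_isoM_of_liftExists p E e, good_liftExists_of_char_of_cont p E e hker⟩

/-- **For a family of good-place data, `UniqueLifting ⟹ hcont` at every place** (unconditional).
[cite: LANA2026Report, §5.3 (a) p. 29] [cite: MochizukiAbsTopIII2015, Proposition 3.2 (iv) p.72] -/
theorem continuous_isoM_of_uniqueLifting_good {V : Type} (Ev : V → FundamentalExtension.{0})
    (ev : ∀ v, (Ev v).gal ≃ₜ* PadicGal p) (h : UniqueLifting (fun v => RefLocalDatum.ofExtension p (Ev v) (ev v)))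
    (v : V) (f : GaloisMonoidPair.Iso (goodPair p (Ev v) (ev v)) (goodPair p (Ev v) (ev v))) :
    Continuous f.isoM ∧ Continuous f.isoM.symm :=
  good_continuous_isoM_of_liftExists p (Ev v) (ev v) (liftExists_of_uniqueLifting h v) f

/-- **For a family of good-place data with characteristic `Δ_v`, `UniqueLifting ⟺ (hcont at every place)`**
(`⟸` is gen 5's `good_uniqueLifting_of_char_of_cont`). [cite: LANA2026Report, §5.3 (a) p. 29]
[cite: MochizukiAbsTopIII2015, Proposition 3.2 (iv) p.72] -/
theorem good_uniqueLifting_iff_cont_of_char {V : Type} (Ev : V → FundamentalExtension.{0})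
    (ev : ∀ v, (Ev v).gal ≃ₜ* PadicGal p)
    (hker : ∀ v, Literature.AnabelianGeometry.EtaleTheta.IsTopCharacteristic (Ev v).arith (Ev v).geom) :
    UniqueLifting (fun v => RefLocalDatum.ofExtension p (Ev v) (ev v)) ↔
      ∀ v (f : GaloisMonoidPair.Iso (goodPair p (Ev v) (ev v)) (goodPair p (Ev v) (ev v))),
        Continuous f.isoM ∧ Continuous f.isoM.symm :=
  ⟨fun h v f => continuous_isoM_of_uniqueLifting_good p Ev ev h v f, good_uniqueLifting_of_char_of_cont p Ev ev hker⟩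

end Good

/-! ## 3 ter. Bad-place data `RefLocalDatum.ofTemperedCurve X` (`Π_v = Π^temp_{X_K}` tempered) -/

section Bad

open Literature.AnabelianGeometry.SemiGraphs Literature.NumberTheory.GaloisRepresentations

variable {p : ℕ} [Fact p.Prime]

namespace TemperedCurveRef

variable (X : TemperedCurve p)

/-- **At a bad-place datum, `LiftExists ⟹ hcont`** (unconditional: uniqueness `bad_liftUnique` is a theorem).
[cite: LANA2026Report, §5.3 (a) p. 29, Def. 3.7.1 p. 20] [cite: MochizukiAbsTopIII2015, Proposition 3.2 (iv) p.72] -/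
theorem bad_continuous_isoM_of_liftExists (hE : (RefLocalDatum.ofTemperedCurve X).LiftExists)
    (f : GaloisMonoidPair.Iso (badPair X) (badPair X)) : Continuous f.isoM ∧ Continuous f.isoM.symm :=
  (RefLocalDatum.ofTemperedCurve X).continuous_isoM_of_liftExists (badRef_stabilizer_isOpen X)
    (isMLFGaloisMonoidPair_badPair X) hE f

/-- **At a bad-place datum, `hcont` holds over INNER automorphisms of `Π^temp_{X_K}`** (the monoid part is the action
of the image of `π` in `G_K`). [cite: MochizukiAbsTopIII2015, Proposition 3.2 (iv) p.72] [cite: LANA2026Report, Def. 3.7.1 p. 20] -/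
theorem bad_continuous_isoM_of_inner (f : GaloisMonoidPair.Iso (badPair X) (badPair X)) (π : X.PiTemp)
    (h : ∀ σ : X.PiTemp, f.isoPi σ = π * σ * π⁻¹) : Continuous f.isoM ∧ Continuous f.isoM.symm :=
  (RefLocalDatum.ofTemperedCurve X).continuous_isoM_of_isoPi_inner (badRef_stabilizer_isOpen X)
    (isMLFGaloisMonoidPair_badPair X) f π h

/-- **At a bad-place datum with tempered first-countable `Π_v` and characteristic `Δ_v`, `LiftExists ⟺ hcont`**
(`⟸` is w6-d027 gen 2's `bad_liftExists_of_char_of_cont`). [cite: LANA2026Report, §5.3 (a) p. 29]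
[cite: MochizukiSemiAnbd2006, Ex 3.10 p.43] [cite: MochizukiAbsTopIII2015, Proposition 3.2 (iv) p.72] -/
theorem bad_liftExists_iff_cont_of_char [FirstCountableTopology X.PiTemp] (hX : IsTempered X.PiTemp)
    (hker : Literature.AnabelianGeometry.EtaleTheta.IsTopCharacteristic X.PiTemp X.DeltaTemp) :
    (RefLocalDatum.ofTemperedCurve X).LiftExists ↔
      ∀ f : GaloisMonoidPair.Iso (badPair X) (badPair X), Continuous f.isoM ∧ Continuous f.isoM.symm :=
  ⟨bad_continuous_isoM_of_liftExists X, bad_liftExists_of_char_of_cont X hX hker⟩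

/-- **For a family of bad-place data, `UniqueLifting ⟹ hcont` at every place** (unconditional).
[cite: LANA2026Report, §5.3 (a) p. 29] [cite: MochizukiAbsTopIII2015, Proposition 3.2 (iv) p.72] -/
theorem continuous_isoM_of_uniqueLifting_bad {V : Type} (Xv : V → TemperedCurve p)
    (h : UniqueLifting (fun v => RefLocalDatum.ofTemperedCurve (Xv v))) (v : V)
    (f : GaloisMonoidPair.Iso (badPair (Xv v)) (badPair (Xv v))) : Continuous f.isoM ∧ Continuous f.isoM.symm :=
  bad_continuous_isoM_of_liftExists (Xv v) (liftExists_of_uniqueLifting h v) f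

end TemperedCurveRef

end Bad

end IUTFork

end Summit.ABC

end
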